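import Literature.NumberTheory.Transcendental.RoySmallValueRoyD
import Literature.NumberTheory.Transcendental.RoySmallValueDerivationAlgebra
import Mathlib.Analysis.Complex.CauchyIntegral
import HarnessLib

/-!
# Roy's small value estimate for `𝔾ₐ × 𝔾ₘ` — Step 1 of the proof of Theorem 1.1 (the forms `P̃_D`)

Topic `Literature/NumberTheory/Transcendental`. Part of the formalisation of the proof of Roy 2013,
Theorem 1.1 (named fact `roy2013_thm_1_1`, `RoySmallValueEstimates.lean`). Source: D. Roy,
*A small value estimate for `𝔾ₐ × 𝔾ₘ`*, Mathematika 59 (2013) 333–363 = arXiv:1301.0663, §7,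
Step 1 (p. 18 of the arXiv text):

> [...] denote by `P̃_D` the homogeneous polynomial of `ℤ[X]_D` determined by the condition
> `P̃_D(1, X₁, X₂) = X₁^a X₂^{−b} P_D(X₁, X₂)` where `b` stands for the largest integer such that
> `X₂^b` divides `P_D`, and where `a = D − deg(P_D) + b`. Then, by construction, `P̃_D` is not
> divisible by `X₀` nor by `X₂`. [...] `‖Q‖ ≤ D^j 𝓛(P̃_D) ≤ D^j (D+1)² ‖P_D‖` [...]
> `|𝒟ⁱQ(1,γ)| = |𝒟₁^{i+j}(X₁^a X₂^{−b} P_D(X₁,X₂))|_{X₁=ξ,X₂=η} ≤ [...]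
> ≤ max{1, |ξ|, |η|⁻¹}^{a+b} (a+b+1)^{3⌊D^τ⌋} exp(−D^ν)`.

We construct `P̃ = royTilde D P` for any non-zero `P ∈ ℤ[X₁, X₂]` with `deg P ≤ D` (as the tree's
integer homogenisation `NguyenRoy.homogInt D (X₁^a P₁)`, `P = X₂^b P₁`, `NguyenRoy.exists_eq_X_pow_mul`)
and prove the displayed properties: `P̃ ∈ ℤ[X]_D` (`isHomogeneous_royTilde`), `X₀ ∤ P̃`, `X₂ ∤ P̃`
(`not_X_zero_dvd_royTilde`, `not_X_two_dvd_royTilde`), `𝓛(P̃) ≤ (D+1)² ‖P‖`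
(`l1Norm_royTilde_le`), the derivatives `𝒟ʲP̃` have integer coefficients (`map_iterate_homDK`),
and the value estimate (`norm_aeval_iterate_homD_royTilde_le`, through the generating function
`(ξ+z)^a (ηe^z)^{−b} P(ξ+z, ηe^z)` and Leibniz's rule). Everything is proved; the definitions are
the objects of the printed proof; no named facts.

## References

* [Roy2013] D. Roy, *A small value estimate for 𝔾ₐ × 𝔾ₘ*, Mathematika 59 (2013), 333–363
  (arXiv:1301.0663), §7, Step 1.
-/

noncomputable section

open MvPolynomial Complex Finset

namespace Literature.NumberTheory.Transcendental

namespace Roy2013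

open Nesterenko

/-! ### The data `b`, `P₁`, `a` and the form `P̃` -/

/-- `b` = the largest power of `X₂` dividing `P` (`X₂` = variable `1` of `ℤ[X₁, X₂]`).
[cite: Roy2013, §7, Step 1] -/
def stepB {P : MvPolynomial (Fin 2) ℤ} (hP : P ≠ 0) : ℕ :=
  Classical.choose (NguyenRoy.exists_eq_X_pow_mul hP 1)

/-- `P₁ = P / X₂^b`. [cite: Roy2013, §7, Step 1] -/
def stepP1 {P : MvPolynomial (Fin 2) ℤ} (hP : P ≠ 0) : MvPolynomial (Fin 2) ℤ :=
  Classical.choose (Classical.choose_spec (NguyenRoy.exists_eq_X_pow_mul hP 1))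

/-- The defining properties of `b, P₁`. [cite: Roy2013, §7, Step 1] -/
theorem stepP1_spec {P : MvPolynomial (Fin 2) ℤ} (hP : P ≠ 0) :
    P = X 1 ^ stepB hP * stepP1 hP ∧
      (∀ d, coeff d (stepP1 hP) = coeff (Finsupp.single 1 (stepB hP) + d) P) ∧
      (∃ d ∈ (stepP1 hP).support, d 1 = 0) ∧ (stepP1 hP).totalDegree ≤ P.totalDegree ∧
      stepB hP ≤ P.totalDegree ∧ (stepP1 hP).support.card ≤ P.support.card :=
  Classical.choose_spec (Classical.choose_spec (NguyenRoy.exists_eq_X_pow_mul hP 1))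

/-- `P₁ ≠ 0`. [folklore] -/
theorem stepP1_ne_zero {P : MvPolynomial (Fin 2) ℤ} (hP : P ≠ 0) : stepP1 hP ≠ 0 := by
  intro h
  have h1 := (stepP1_spec hP).1
  rw [h, mul_zero] at h1
  exact hP h1

/-- `a = D − deg P₁` (`= D − deg P + b`). [cite: Roy2013, §7, Step 1] -/
def stepA (D : ℕ) {P : MvPolynomial (Fin 2) ℤ} (hP : P ≠ 0) : ℕ := D - (stepP1 hP).totalDegree

/-- `X₁^a P₁ ∈ ℤ[X₁, X₂]`, of total degree exactly `D`. [cite: Roy2013, §7, Step 1] -/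
def stepF (D : ℕ) {P : MvPolynomial (Fin 2) ℤ} (hP : P ≠ 0) : MvPolynomial (Fin 2) ℤ :=
  X 0 ^ stepA D hP * stepP1 hP

/-- `deg (X₁^a P₁) = D` when `deg P ≤ D`. [folklore] -/
theorem totalDegree_stepF {D : ℕ} {P : MvPolynomial (Fin 2) ℤ} (hP : P ≠ 0)
    (hD : P.totalDegree ≤ D) : (stepF D hP).totalDegree = D := by
  have h1 := (stepP1_spec hP).2.2.2.1
  rw [stepF, totalDegree_mul_of_isDomain (pow_ne_zero _ (X_ne_zero _)) (stepP1_ne_zero hP),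
    totalDegree_X_pow, stepA]
  omega

/-- **`P̃`**: the form of degree `D` with `P̃(1, X₁, X₂) = X₁^a X₂^{−b} P(X₁, X₂)`.
[cite: Roy2013, §7, Step 1] -/
def royTilde (D : ℕ) {P : MvPolynomial (Fin 2) ℤ} (hP : P ≠ 0) : MvPolynomial (Fin 3) ℤ :=
  NguyenRoy.homogInt D (stepF D hP)

/-- `P̃ ∈ ℤ[X]_D`. [cite: Roy2013, §7, Step 1] -/
theorem isHomogeneous_royTilde {D : ℕ} {P : MvPolynomial (Fin 2) ℤ} (hP : P ≠ 0)
    (hD : P.totalDegree ≤ D) : (royTilde D hP).IsHomogeneous D :=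
  NguyenRoy.isHomogeneous_homogInt D _ (totalDegree_stepF hP hD).le

/-- The complexification of `P̃` is a form of degree `D`. [cite: Roy2013, §7, Step 1] -/
theorem isHomogeneous_map_royTilde {D : ℕ} {P : MvPolynomial (Fin 2) ℤ} (hP : P ≠ 0)
    (hD : P.totalDegree ≤ D) : (map (Int.castRingHom ℂ) (royTilde D hP)).IsHomogeneous D := by
  intro d hd
  rw [coeff_map] at hd
  exact isHomogeneous_royTilde hP hD (fun h => hd (by rw [h, map_zero]))

/-- `P̃ ≠ 0`. [folklore] -/
theorem royTilde_ne_zero {D : ℕ} {P : MvPolynomial (Fin 2) ℤ} (hP : P ≠ 0) : royTilde D hP ≠ 0 :=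
  NguyenRoy.homogInt_ne_zero D _ (by
    rw [stepF]; exact mul_ne_zero (pow_ne_zero _ (X_ne_zero _)) (stepP1_ne_zero hP))

/-- The complexification of `P̃` is non-zero. [folklore] -/
theorem map_royTilde_ne_zero {D : ℕ} {P : MvPolynomial (Fin 2) ℤ} (hP : P ≠ 0) :
    map (Int.castRingHom ℂ) (royTilde D hP) ≠ 0 := fun h =>
  royTilde_ne_zero (D := D) hP
    (map_injective (Int.castRingHom ℂ) Int.cast_injective (by rw [h, map_zero]))

/-! ### `X₀ ∤ P̃` and `X₂ ∤ P̃` -/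

/-- A polynomial with a monomial free of `X_k` is not divisible by `X_k`. [folklore] -/
theorem not_X_dvd_of_mem_support {K : Type*} [CommRing K] [IsDomain K] {G : MvPolynomial (Fin 3) K}
    {e : Fin 3 →₀ ℕ} (he : e ∈ G.support) {k : Fin 3} (hek : e k = 0) : ¬(X k : MvPolynomial (Fin 3) K) ∣ G := by
  rintro ⟨H, rfl⟩
  rw [mem_support_iff, coeff_X_mul'] at he
  apply he
  rw [if_neg (by rw [Finsupp.mem_support_iff, not_not]; exact hek)]

/-- **`X₀ ∤ P̃`.** [cite: Roy2013, §7, Step 1 ("by construction, `P̃_D` is not divisible by `X₀`")] -/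
theorem not_X_zero_dvd_royTilde {D : ℕ} {P : MvPolynomial (Fin 2) ℤ} (hP : P ≠ 0)
    (hD : P.totalDegree ≤ D) : ¬(X 0 : CX) ∣ map (Int.castRingHom ℂ) (royTilde D hP) := by
  obtain ⟨e, he, he0⟩ := NguyenRoy.exists_mem_support_homogInt_zero D (stepF D hP)
    (by rw [stepF]; exact mul_ne_zero (pow_ne_zero _ (X_ne_zero _)) (stepP1_ne_zero hP))
    (totalDegree_stepF hP hD).symm
  refine not_X_dvd_of_mem_support (e := e) ?_ he0
  rw [mem_support_iff, royTilde, coeff_map]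
  refine fun h => (mem_support_iff.mp he) ?_
  have h' : ((coeff e (NguyenRoy.homogInt D (stepF D hP)) : ℤ) : ℂ) = 0 := h
  exact_mod_cast h'

/-- **`X₂ ∤ P̃`.** [cite: Roy2013, §7, Step 1 ("nor by `X₂`")] -/
theorem not_X_two_dvd_royTilde {D : ℕ} {P : MvPolynomial (Fin 2) ℤ} (hP : P ≠ 0) :
    ¬(X 2 : CX) ∣ map (Int.castRingHom ℂ) (royTilde D hP) := by
  classical
  -- `X₁^a P₁` has a monomial free of `X₂` (variable `1` of `ℤ[X₁,X₂]`)
  have h1 : ∃ d ∈ (stepF D hP).support, d 1 = 0 := by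
    obtain ⟨d₀, hd₀, hd₀1⟩ := (stepP1_spec hP).2.2.1
    refine ⟨Finsupp.single 0 (stepA D hP) + d₀, ?_, by simp [hd₀1]⟩
    rw [mem_support_iff, stepF, X_pow_eq_monomial, coeff_monomial_mul', if_pos le_self_add,
      add_tsub_cancel_left, one_mul]
    exact mem_support_iff.mp hd₀
  obtain ⟨e, he, he2⟩ := NguyenRoy.exists_mem_support_homogInt_succ D (stepF D hP) (k := 1) h1
  refine not_X_dvd_of_mem_support (e := e) ?_ he2
  rw [mem_support_iff, royTilde, coeff_map]
  refine fun h => (mem_support_iff.mp he) ?_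
  have h' : ((coeff e (NguyenRoy.homogInt D (stepF D hP)) : ℤ) : ℂ) = 0 := h
  exact_mod_cast h'

/-! ### The length of `P̃` -/

/-- Multiplying by `X₁^a` does not increase the number of monomials. [folklore] -/
theorem card_support_stepF_le {D : ℕ} {P : MvPolynomial (Fin 2) ℤ} (hP : P ≠ 0) :
    (stepF D hP).support.card ≤ P.support.card := by
  classical
  refine le_trans ?_ (stepP1_spec hP).2.2.2.2.2
  rw [stepF]
  refine (Finset.card_le_card (support_mul _ _)).trans ?_
  refine (Finset.card_add_le).trans ?_
  rw [support_X_pow, Finset.card_singleton, one_mul]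

/-- The coefficients of `X₁^a P₁` are coefficients of `P`. [folklore] -/
theorem mvPolyHeight_stepF_le {D : ℕ} {P : MvPolynomial (Fin 2) ℤ} (hP : P ≠ 0) :
    mvPolyHeight (stepF D hP) ≤ mvPolyHeight P := by
  classical
  rw [mvPolyHeight]
  refine Finset.sup_le fun d _ => ?_
  change (coeff d (stepF D hP)).natAbs ≤ mvPolyHeight P
  rw [stepF, X_pow_eq_monomial, coeff_monomial_mul']
  split_ifs with h
  · rw [one_mul, (stepP1_spec hP).2.1]
    exact natAbs_coeff_le_mvPolyHeight P _
  · exact Nat.zero_le _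

/-- **`𝓛(P̃) ≤ (D+1)² ‖P‖`.** [cite: Roy2013, §7, Step 1] -/
theorem l1Norm_royTilde_le {D : ℕ} {P : MvPolynomial (Fin 2) ℤ} (hP : P ≠ 0)
    (hD : P.totalDegree ≤ D) :
    l1Norm (map (Int.castRingHom ℂ) (royTilde D hP)) ≤ ((D + 1) ^ 2 : ℕ) * mvPolyHeight P := by
  refine (NguyenRoy.l1Norm_map_homogInt_le D (stepF D hP)).trans ?_
  have h1 : ((stepF D hP).support.card : ℝ) ≤ ((D + 1) ^ 2 : ℕ) := by
    exact_mod_cast (card_support_stepF_le hP).trans (NguyenRoy.card_support_le_sq P hD)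
  have h2 : (mvPolyHeight (stepF D hP) : ℝ) ≤ mvPolyHeight P := by
    exact_mod_cast mvPolyHeight_stepF_le hP
  exact mul_le_mul h1 h2 (by positivity) (by positivity)

/-! ### Integrality of the derivatives -/

/-- Base change commutes with `𝒟`. [folklore] -/
theorem map_homDK {K K' : Type*} [CommRing K] [CommRing K'] (f : K →+* K')
    (G : MvPolynomial (Fin 3) K) : map f (homDK K G) = homDK K' (map f G) := by
  rw [homDK_apply, homDK_apply, map_add, map_mul, map_mul, map_X, map_X, pderiv_map, pderiv_map]

/-- Base change commutes with `𝒟ʲ`; in particular `𝒟ʲP̃` has integer coefficients.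
[cite: Roy2013, §7, Step 1 (`𝒟ʲP̃_D ∈ ℤ[X]_D`)] -/
theorem map_iterate_homDK (j : ℕ) (G : MvPolynomial (Fin 3) ℤ) :
    map (Int.castRingHom ℂ) ((homDK ℤ)^[j] G) = homD^[j] (map (Int.castRingHom ℂ) G) := by
  induction j generalizing G with
  | zero => rfl
  | succ j ih =>
    rw [Function.iterate_succ_apply', Function.iterate_succ_apply', map_homDK, ih, homDK_complex]

/-! ### The values `𝒟ᵏP̃(1, ξ, η)` -/

/-- Iterated derivatives of `z ↦ (ξ + z)^a` at `0`. [folklore] -/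
theorem norm_iteratedDeriv_pow_add_le (ξ : ℂ) (a r : ℕ) :
    ‖iteratedDeriv r (fun z : ℂ => (ξ + z) ^ a) 0‖ ≤ (a : ℝ) ^ r * max 1 ‖ξ‖ ^ a := by
  have h := congr_fun (iteratedDeriv_comp_const_add (n := r) (f := fun w : ℂ => w ^ a) (s := ξ)) 0
  rw [h, iteratedDeriv_pow, add_zero, norm_mul, Complex.norm_natCast, norm_pow]
  refine mul_le_mul ?_ ?_ (by positivity) (by positivity)
  · exact_mod_cast Nat.descFactorial_le_pow a r
  · exact (pow_le_pow_left₀ (norm_nonneg _) (le_max_right 1 ‖ξ‖) _).trans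
      (pow_le_pow_right₀ (le_max_left _ _) (Nat.sub_le a r))

/-- Iterated derivatives of `z ↦ c e^{−bz}` at `0`. [folklore] -/
theorem norm_iteratedDeriv_const_mul_cexp (c : ℂ) (b s : ℕ) :
    ‖iteratedDeriv s (fun z : ℂ => c * cexp (-(b : ℂ) * z)) 0‖ = ‖c‖ * (b : ℝ) ^ s := by
  rw [iteratedDeriv_const_mul_field, congr_fun (iteratedDeriv_cexp_const_mul s (-(b : ℂ))) 0]
  simp [norm_pow, norm_neg]

/-- **Roy 2013, §7, Step 1: the values `𝒟ᵏP̃(1, γ)`.** If `|𝒟₁ᵗP(ξ, η)| ≤ W` for `t ≤ k` then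
`|𝒟ᵏP̃(1, ξ, η)| ≤ (2D+1)^k · max(1,|ξ|)^D · max(1,|η|⁻¹)^D · W` (`η ≠ 0`; Roy:
`≤ max{1,|ξ|,|η|⁻¹}^{a+b} (a+b+1)^k max_t |𝒟₁ᵗP_D(ξ,η)|`). [cite: Roy2013, §7, Step 1] -/
theorem norm_aeval_iterate_homD_royTilde_le {D : ℕ} {P : MvPolynomial (Fin 2) ℤ} (hP : P ≠ 0)
    (hD : P.totalDegree ≤ D) {ξ η : ℂ} (hη : η ≠ 0) (k : ℕ) {W : ℝ}
    (hW : ∀ t ≤ k, ‖aeval ![ξ, η] (royD^[t] P)‖ ≤ W) :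
    ‖aeval ![1, ξ, η] (homD^[k] (map (Int.castRingHom ℂ) (royTilde D hP)))‖ ≤
      (2 * D + 1 : ℝ) ^ k * (max 1 ‖ξ‖ ^ D * max 1 ‖η‖⁻¹ ^ D) * W := by
  have hspec := stepP1_spec hP
  set a := stepA D hP with ha_def
  set b := stepB hP with hb_def
  set P₁ := stepP1 hP with hP₁_def
  have ha : a ≤ D := Nat.sub_le _ _
  have hb : b ≤ D := hspec.2.2.2.2.1.trans hD
  have hW0 : 0 ≤ W := (norm_nonneg _).trans (hW 0 (Nat.zero_le _))
  -- the generating functions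
  set g : ℂ → ℂ := expEval2 (stepF D hP) ξ η with hg_def
  set f : ℂ → ℂ := expEval2 P ξ η with hf_def
  set f₁ : ℂ → ℂ := expEval2 P₁ ξ η with hf₁_def
  set h : ℂ → ℂ := fun z => (ξ + z) ^ a * ((η⁻¹) ^ b * cexp (-(b : ℂ) * z)) with hh_def
  have hval : aeval ![1, ξ, η] (homD^[k] (map (Int.castRingHom ℂ) (royTilde D hP))) =
      iteratedDeriv k g 0 := by
    rw [hg_def, iteratedDeriv_expEval2_zero]
    exact aeval_iterate_homD_homogC D (stepF D hP) ξ η k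
  have hg : ∀ z, g z = (ξ + z) ^ a * f₁ z := fun z => by
    simp only [hg_def, hf₁_def, expEval2, stepF, map_mul, map_pow, aeval_X, Matrix.cons_val_zero]
    rfl
  have hf : ∀ z, f z = (η * cexp z) ^ b * f₁ z := fun z => by
    have h1 := congrArg (fun Q => expEval2 Q ξ η z) hspec.1
    simp only [expEval2, map_mul, map_pow, aeval_X, Matrix.cons_val_one] at h1
    exact h1
  have hgf : g = fun z => h z * f z := by
    funext z
    rw [hg, hf, hh_def]
    have he : cexp (-(b : ℂ) * z) * cexp z ^ b = 1 := by
      rw [← Complex.exp_nat_mul, ← Complex.exp_add, neg_mul, neg_add_cancel, Complex.exp_zero]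
    have hη' : (η⁻¹) ^ b * η ^ b = 1 := by rw [← mul_pow, inv_mul_cancel₀ hη, one_pow]
    calc (ξ + z) ^ a * f₁ z = (ξ + z) ^ a * f₁ z * ((η⁻¹) ^ b * η ^ b) * (cexp (-(b : ℂ) * z) *
          cexp z ^ b) := by rw [he, hη', mul_one, mul_one]
      _ = _ := by rw [mul_pow]; ring
  -- smoothness
  have hhs : ContDiff ℂ ⊤ h := by
    refine ((contDiff_const.add contDiff_id).pow a).mul (contDiff_const.mul ?_)
    exact Complex.contDiff_exp.comp (contDiff_const.mul contDiff_id)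
  have hfs : ContDiff ℂ ⊤ f := (differentiable_expEval2 P ξ η).contDiff
  -- derivatives of `h`
  have hh_le : ∀ i, ‖iteratedDeriv i h 0‖ ≤ max 1 ‖ξ‖ ^ a * ‖η‖⁻¹ ^ b * ((a : ℝ) + b) ^ i := by
    intro i
    have h1s : ContDiff ℂ ⊤ (fun z : ℂ => (ξ + z) ^ a) := (contDiff_const.add contDiff_id).pow a
    have h2s : ContDiff ℂ ⊤ (fun z : ℂ => (η⁻¹) ^ b * cexp (-(b : ℂ) * z)) :=
      contDiff_const.mul (Complex.contDiff_exp.comp (contDiff_const.mul contDiff_id))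
    have hprod : h = (fun z : ℂ => (ξ + z) ^ a) * (fun z : ℂ => (η⁻¹) ^ b * cexp (-(b : ℂ) * z)) :=
      rfl
    rw [hprod, iteratedDeriv_mul (h1s.contDiffAt.of_le le_top) (h2s.contDiffAt.of_le le_top)]
    refine (norm_sum_le _ _).trans ?_
    calc ∑ r ∈ range (i + 1), ‖(i.choose r : ℂ) * iteratedDeriv r (fun z : ℂ => (ξ + z) ^ a) 0 *
          iteratedDeriv (i - r) (fun z : ℂ => (η⁻¹) ^ b * cexp (-(b : ℂ) * z)) 0‖
        ≤ ∑ r ∈ range (i + 1), (i.choose r : ℝ) * ((a : ℝ) ^ r * max 1 ‖ξ‖ ^ a) *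
            (‖η‖⁻¹ ^ b * (b : ℝ) ^ (i - r)) := by
          refine Finset.sum_le_sum fun r _ => ?_
          rw [norm_mul, norm_mul, Complex.norm_natCast, norm_iteratedDeriv_const_mul_cexp,
            norm_pow, norm_inv]
          exact mul_le_mul (mul_le_mul_of_nonneg_left (norm_iteratedDeriv_pow_add_le ξ a r)
            (by positivity)) le_rfl (by positivity) (by positivity)
      _ = max 1 ‖ξ‖ ^ a * ‖η‖⁻¹ ^ b * ∑ r ∈ range (i + 1), (a : ℝ) ^ r * (b : ℝ) ^ (i - r) *
            (i.choose r : ℝ) := by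
          rw [Finset.mul_sum]; refine Finset.sum_congr rfl fun r _ => ?_; ring
      _ = max 1 ‖ξ‖ ^ a * ‖η‖⁻¹ ^ b * ((a : ℝ) + b) ^ i := by rw [← add_pow]
  -- Leibniz for `g = h f`
  rw [hval, hgf, show (fun z => h z * f z) = h * f from rfl,
    iteratedDeriv_mul (hhs.contDiffAt.of_le le_top) (hfs.contDiffAt.of_le le_top)]
  refine (norm_sum_le _ _).trans ?_
  have hfW : ∀ i ∈ range (k + 1), ‖iteratedDeriv (k - i) f 0‖ ≤ W := fun i _ => by
    rw [hf_def, iteratedDeriv_expEval2_zero]; exact hW _ (Nat.sub_le _ _)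
  calc ∑ i ∈ range (k + 1), ‖(k.choose i : ℂ) * iteratedDeriv i h 0 * iteratedDeriv (k - i) f 0‖
      ≤ ∑ i ∈ range (k + 1), (k.choose i : ℝ) * (max 1 ‖ξ‖ ^ a * ‖η‖⁻¹ ^ b * ((a : ℝ) + b) ^ i) *
          W := by
        refine Finset.sum_le_sum fun i hi => ?_
        rw [norm_mul, norm_mul, Complex.norm_natCast]
        exact mul_le_mul (mul_le_mul_of_nonneg_left (hh_le i) (by positivity)) (hfW i hi)
          (by positivity) (by positivity)
    _ = max 1 ‖ξ‖ ^ a * ‖η‖⁻¹ ^ b * W * ∑ i ∈ range (k + 1), ((a : ℝ) + b) ^ i * 1 ^ (k - i) *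
          (k.choose i : ℝ) := by
        rw [Finset.mul_sum]; refine Finset.sum_congr rfl fun i _ => ?_; ring
    _ = max 1 ‖ξ‖ ^ a * ‖η‖⁻¹ ^ b * W * ((a : ℝ) + b + 1) ^ k := by rw [← add_pow]
    _ ≤ (2 * D + 1 : ℝ) ^ k * (max 1 ‖ξ‖ ^ D * max 1 ‖η‖⁻¹ ^ D) * W := by
        have h1 : max 1 ‖ξ‖ ^ a ≤ max 1 ‖ξ‖ ^ D := pow_le_pow_right₀ (le_max_left _ _) ha
        have h2 : ‖η‖⁻¹ ^ b ≤ max 1 ‖η‖⁻¹ ^ D :=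
          (pow_le_pow_left₀ (by positivity) (le_max_right _ _) _).trans
            (pow_le_pow_right₀ (le_max_left _ _) hb)
        have h3 : ((a : ℝ) + b + 1) ^ k ≤ (2 * D + 1 : ℝ) ^ k := by
          refine pow_le_pow_left₀ (by positivity) ?_ _
          have : (a : ℝ) ≤ D := by exact_mod_cast ha
          have : (b : ℝ) ≤ D := by exact_mod_cast hb
          linarith
        calc max 1 ‖ξ‖ ^ a * ‖η‖⁻¹ ^ b * W * ((a : ℝ) + b + 1) ^ k
            ≤ max 1 ‖ξ‖ ^ D * max 1 ‖η‖⁻¹ ^ D * W * (2 * D + 1 : ℝ) ^ k := by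
              gcongr
          _ = _ := by ring

end Roy2013

end Literature.NumberTheory.Transcendental
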